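import Summits.PneNP.GCT.Max.DetKYLeadingTerms
import HarnessLib
import HarnessLib.Audit

/-!
# `GCT/Max`: the ORDER-OPTIMISED distinct-leading-term bound `LT2_σ(n,p,k) ≤ rank KY_{p,k}(det_n)` (W2a of theory-2's
# memo `FINDINGS-LT2.md`; cell `pub-gct-max`, track F)

Companion / strengthening of `Summits/PneNP/GCT/Max/DetKYLeadingTerms.lean` (`DetKYLeadingTermBound`: the count `LT` of ONE
explicit family). Here we count ALL DISTINCT LEADING LABELS over ALL basis tensors, for an ARBITRARY total order of the matrix
positions (a permutation `σ` of `Fin (n*n)`; `σ = 1` is the row-major/colex order of `DetKYLeadingTermBound`).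

**Mathematics.** Positions `Fin n × Fin n ≃ Fin (n*n)` (`vpos`). A LABEL is `(T, I′, J′)` with `|T| = p+1`, `|I′| = |J′| = k+1`; it
is `σ`-ACHIEVABLE with WITNESS `(r, c) ∈ I′ × J′` if `vpos (r,c) ∈ T` and every position `q ∉ T` with `σ q > σ (vpos (r,c))` lies in a row of
`I′ \ {r}` or a column of `J′ \ {c}` (`block`). Then `(T, I′, J′)` is the `σ`-colex-LEADING label of the basis tensor
`∂^{l} ⊗ e_S`, `S = T \ {(r,c)}`, `l` = the `k` variables `x_{π b, b}` (`b ∈ J′ \ {c}`, `π` a bijection onto `I′ \ {r}`): its image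
`Σ_{t ∉ S} ε(S,t) ∂_t ∂^l det_n ⊗ e_{S ⊔ t}` (tree `kyImage`) has the component `ε · (± minor off rows I′, columns J′) ≠ 0` at `T = S ⊔ (r,c)`
(`iterPDeriv_permSum`), the component `0` at `S ⊔ q` for `q` in the block (a repeated row or column: `iterPDeriv_permSum_eq_zero`), and all
other components sit at `S ⊔ q` with `σ q < σ (r,c)`, i.e. colex-below `T` after transporting by `σ` (`Finset.Colex.insert_lt_insert`).
Labels with the same `T` but different `(I′, J′)` have disjointly supported values (`DetKYLeadingTerms.disjoint_support_canon`). Hence the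
tree device `card_le_kyRankFin_of_leading_disjoint` gives `#(σ-achievable labels) ≤ rank`. The count `lt2Count n p k σ` is DEFINED as the
cardinality of the (decidable) finset of achievable labels; its closed evaluation (inclusion–exclusion over the `(k+1)²` witnesses, memo Thm 2)
is NOT needed for this bound and is the companion module `Max/DetKYLeadingTermsTwoCount.lean`. Sanity (kernel): `lt2Count 3 4 1 1 = 726`
(row-major order `σ = 1`; the diagonal sweep of the memo gives `865`; `rank KY_{4,1}(det₃) = 950`; one family: `ltCount 3 4 1 = 361`).

PACKAGED (PROVED): `DetKYLeadingTermBoundTwo` (`LT2_σ ≤ rank`, every order `σ`) and `DetKYLeadingTermBoundTwoDual` (two orders at once via the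
transpose duality of `det_n`: `max (LT2_σ(n,p,k)) (LT2_τ(n,n²-1-p,n-1-k)) ≤ rank KY_{p,k}(det_n)` for `p+1 ≤ n²`, `k+1 ≤ n`).

HONEST FRAMING: an ingredient of METHOD-CEILING statements for ONE flattening family (plain Koszul–Young) at explicit parameters; nothing here
bears on dc(per_m), VP vs VNP or P vs NP. Mathematics: theory-2 gen 27 (memo FINDINGS-LT2 §1); the device and its ingredients are textbook
([LandsbergGCT2017] §8.2.1, Exercise 6.2.2.7; [CoxLittleOShea2007] Ch. 9 §3); this bound itself is the cell's, not a printed theorem.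
-/

noncomputable section

open MvPolynomial Finset

namespace Summit.PneNP.GCT

open Literature.Computability.AlgebraicComplexity Literature.Barriers.ValiantsHypothesis

namespace DetKYLeadingTermsTwo

open DetKYLeadingTerms (vpos sgnK canon_sgn_ne_zero koszulSign_cast_ne_zero disjoint_support_canon)

variable {K : Type*} [Field K] {n p k : ℕ} {σ : Equiv.Perm (Fin (n * n))}

/-! ### Achievability witnesses, achievable labels and the count `LT2` -/

/-- The block of a witness `(r, c)` relative to the label rows `I'` and columns `J'`: positions in a row of `I' \ {r}` or in a
column of `J' \ {c}`. [folklore] -/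
def block (n : ℕ) (I' J' : Finset (Fin n)) (r c : Fin n) : Finset (Fin (n * n)) :=
  univ.filter fun q => ((vpos n).symm q).1 ∈ I'.erase r ∨ ((vpos n).symm q).2 ∈ J'.erase c

/-- The `σ`-achievability WITNESSES `(r, c)` of the label `(T, I', J')`: `r ∈ I'`, `c ∈ J'`, `(r, c) ∈ T`, and every position
`σ`-above `(r, c)` outside `T` lies in the block of `(r, c)` (a finset of data; the label is `σ`-achievable iff it is nonempty). [folklore] -/
def witnesses (n : ℕ) (σ : Equiv.Perm (Fin (n * n))) (T : Finset (Fin (n * n))) (I' J' : Finset (Fin n)) :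
    Finset (Fin n × Fin n) :=
  univ.filter fun w => w.1 ∈ I' ∧ w.2 ∈ J' ∧ vpos n w ∈ T ∧
    ∀ q : Fin (n * n), σ (vpos n w) < σ q → q ∉ T → q ∈ block n I' J' w.1 w.2

/-- Membership in `witnesses`, unfolded. [folklore] -/
theorem mem_witnesses {n : ℕ} {σ : Equiv.Perm (Fin (n * n))} {T : Finset (Fin (n * n))} {I' J' : Finset (Fin n)}
    {w : Fin n × Fin n} : w ∈ witnesses n σ T I' J' ↔ w.1 ∈ I' ∧ w.2 ∈ J' ∧ vpos n w ∈ T ∧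
      ∀ q : Fin (n * n), σ (vpos n w) < σ q → q ∉ T → q ∈ block n I' J' w.1 w.2 := by
  simp only [witnesses, mem_filter, mem_univ, true_and]

/-- The finset of `σ`-achievable labels `(T, I', J')` (nonempty witness set), `|T| = p+1`, `|I'| = |J'| = k+1`. [folklore] -/
def labels (n p k : ℕ) (σ : Equiv.Perm (Fin (n * n))) :
    Finset (Finset (Fin (n * n)) × Finset (Fin n) × Finset (Fin n)) :=
  ((univ : Finset (Fin (n * n))).powersetCard (p + 1) ×ˢ
      ((univ : Finset (Fin n)).powersetCard (k + 1) ×ˢ (univ : Finset (Fin n)).powersetCard (k + 1))).filter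
    fun x => (witnesses n σ x.1 x.2.1 x.2.2).Nonempty

/-- `LT2_σ(n, p, k)` := the number of `σ`-achievable labels. [folklore] -/
def lt2Count (n p k : ℕ) (σ : Equiv.Perm (Fin (n * n))) : ℕ := (labels n p k σ).card

/-- The index type of the new family: achievable labels. [folklore] -/
abbrev Idx (n p k : ℕ) (σ : Equiv.Perm (Fin (n * n))) : Type := ↥(labels n p k σ)

/-- `|Idx| = LT2`. [folklore] -/
theorem card_Idx (n p k : ℕ) (σ : Equiv.Perm (Fin (n * n))) : Fintype.card (Idx n p k σ) = lt2Count n p k σ :=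
  Fintype.card_coe _

section Components

variable (x : Idx n p k σ)

/-- The leading set `T`. [folklore] -/ def lead : Finset (Fin (n * n)) := x.1.1
/-- The `k+1` label rows `I'`. [folklore] -/ def rowL : Finset (Fin n) := x.1.2.1
/-- The `k+1` label columns `J'`. [folklore] -/ def colL : Finset (Fin n) := x.1.2.2

/-- `x` is a label. [folklore] -/ theorem mem_labels : x.1 ∈ labels n p k σ := x.2
/-- The label's defining properties, unfolded. [folklore] -/
theorem spec : (lead x).card = p + 1 ∧ (rowL x).card = k + 1 ∧ (colL x).card = k + 1 ∧
    (witnesses n σ (lead x) (rowL x) (colL x)).Nonempty := by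
  have h := mem_labels x
  simp only [labels, mem_filter, mem_product, mem_powersetCard, subset_univ, true_and] at h
  exact ⟨h.1.1, h.1.2.1, h.1.2.2, h.2⟩

/-- `|T| = p+1`. [folklore] -/ theorem card_lead : (lead x).card = p + 1 := (spec x).1
/-- `|I'| = k+1`. [folklore] -/ theorem card_rowL : (rowL x).card = k + 1 := (spec x).2.1
/-- `|J'| = k+1`. [folklore] -/ theorem card_colL : (colL x).card = k + 1 := (spec x).2.2.1
/-- The label has a witness. [folklore] -/ theorem achievable : (witnesses n σ (lead x) (rowL x) (colL x)).Nonempty := (spec x).2.2.2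

/-- A chosen witness. [folklore] -/ def wit : Fin n × Fin n := (achievable x).choose
/-- The chosen witness is one. [folklore] -/ theorem wit_mem : wit x ∈ witnesses n σ (lead x) (rowL x) (colL x) := (achievable x).choose_spec
/-- Its row. [folklore] -/ def row : Fin n := (wit x).1
/-- Its column. [folklore] -/ def col : Fin n := (wit x).2

/-- The witness property of `(row, col)`, unfolded. [folklore] -/
theorem achievableBy : row x ∈ rowL x ∧ col x ∈ colL x ∧ vpos n (row x, col x) ∈ lead x ∧
    ∀ q : Fin (n * n), σ (vpos n (row x, col x)) < σ q → q ∉ lead x → q ∈ block n (rowL x) (colL x) (row x) (col x) :=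
  mem_witnesses.1 (wit_mem x)

/-- The witness position. [folklore] -/ def dpos : Fin (n * n) := vpos n (row x, col x)

/-- `row ∈ I'`. [folklore] -/ theorem row_mem : row x ∈ rowL x := (achievableBy x).1
/-- `col ∈ J'`. [folklore] -/ theorem col_mem : col x ∈ colL x := (achievableBy x).2.1
/-- The witness position lies in `T`. [folklore] -/ theorem dpos_mem : dpos x ∈ lead x := (achievableBy x).2.2.1
/-- Positions `σ`-above the witness outside `T` lie in its block. [folklore] -/
theorem block_of_gt {q : Fin (n * n)} (hq : σ (dpos x) < σ q) (hqT : q ∉ lead x) :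
    q ∈ block n (rowL x) (colL x) (row x) (col x) := (achievableBy x).2.2.2 q hq hqT

/-- The `k` derivative rows `I' \ {r}`. [folklore] -/
def rowSet : Finset (Fin n) := (rowL x).erase (row x)
/-- The `k` derivative columns `J' \ {c}`. [folklore] -/
def colSet : Finset (Fin n) := (colL x).erase (col x)

/-- `|rowSet| = k`. [folklore] -/
theorem card_rowSet : (rowSet x).card = k := by rw [rowSet, card_erase_of_mem (row_mem x), card_rowL]; rfl
/-- `|colSet| = k`. [folklore] -/
theorem card_colSet : (colSet x).card = k := by rw [colSet, card_erase_of_mem (col_mem x), card_colL]; rfl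
/-- `row ∉ rowSet`. [folklore] -/ theorem row_notMem_rowSet : row x ∉ rowSet x := notMem_erase _ _
/-- `col ∉ colSet`. [folklore] -/ theorem col_notMem_colSet : col x ∉ colSet x := notMem_erase _ _

/-- A permutation carrying `colSet` onto `rowSet` and `col` to `row` (same construction as `DetKYLeadingTerms.exists_perm`). [folklore] -/
theorem exists_perm : ∃ π : Equiv.Perm (Fin n),
    π (col x) = row x ∧ (colSet x).map π.toEmbedding = rowSet x := by
  obtain ⟨π₁, hπ₁⟩ := Equiv.Perm.exists_map_finset_eq (colSet x) (rowSet x)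
    ((card_colSet x).trans (card_rowSet x).symm)
  refine ⟨Equiv.swap (π₁ (col x)) (row x) * π₁, by simp, ?_⟩
  rw [← hπ₁]
  ext r
  simp only [mem_map_equiv]
  constructor
  · intro h
    have h' : π₁.symm (Equiv.swap (π₁ (col x)) (row x) r) ∈ colSet x := by
      simpa [Equiv.Perm.mul_def, Equiv.symm_trans_apply] using h
    have hne1 : r ≠ π₁ (col x) := by
      intro hr
      rw [hr, Equiv.swap_apply_left] at h'
      have : row x ∈ (colSet x).map π₁.toEmbedding := by
        rw [mem_map_equiv]; exact h'
      rw [hπ₁] at this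
      exact row_notMem_rowSet x this
    have hne2 : r ≠ row x := by
      intro hr
      rw [hr, Equiv.swap_apply_right, Equiv.symm_apply_apply] at h'
      exact col_notMem_colSet x h'
    rwa [Equiv.swap_apply_of_ne_of_ne hne1 hne2] at h'
  · intro h
    have hne1 : r ≠ π₁ (col x) := by
      intro hr
      rw [hr, Equiv.symm_apply_apply] at h
      exact col_notMem_colSet x h
    have hne2 : r ≠ row x := by
      intro hr
      have : row x ∈ (colSet x).map π₁.toEmbedding := by rw [mem_map_equiv, ← hr]; exact h
      rw [hπ₁] at this
      exact row_notMem_rowSet x this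
    have : π₁.symm (Equiv.swap (π₁ (col x)) (row x) r) ∈ colSet x := by
      rwa [Equiv.swap_apply_of_ne_of_ne hne1 hne2]
    simpa [Equiv.Perm.mul_def, Equiv.symm_trans_apply] using this

/-- The chosen permutation. [folklore] -/
def perm : Equiv.Perm (Fin n) := (exists_perm x).choose

/-- `perm col = row`. [folklore] -/ theorem perm_col : perm x (col x) = row x := (exists_perm x).choose_spec.1
/-- `perm` carries `colSet` onto `rowSet`. [folklore] -/
theorem map_perm_colSet : (colSet x).map (perm x).toEmbedding = rowSet x := (exists_perm x).choose_spec.2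

/-- `J'` is carried onto `I'`. [folklore] -/
theorem map_perm_colL : (colL x).map (perm x).toEmbedding = rowL x := by
  rw [← insert_erase (col_mem x), ← insert_erase (row_mem x), map_insert, Equiv.toEmbedding_apply, perm_col]
  exact congrArg _ (map_perm_colSet x)

/-- The list of the `k` derivative columns. [folklore] -/
def colList : List (Fin n) := (colSet x).toList
/-- The derivative list in matrix coordinates: the graph of `perm` over `colSet`. [folklore] -/
def dlist : List (Fin n × Fin n) := (colList x).map (grEmb (perm x))
/-- The derivative list in numbered coordinates. [folklore] -/
def dl : List (Fin (n * n)) := (dlist x).map (vpos n)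
/-- The wedge part `S = T \ {witness}`. [folklore] -/
def wS : Finset (Fin (n * n)) := (lead x).erase (dpos x)

/-- `|dl| = k`. [folklore] -/
theorem length_dl : (dl x).length = k := by rw [dl, List.length_map, dlist, List.length_map, colList, length_toList, card_colSet]
/-- `|S| = p`. [folklore] -/
theorem card_wS : (wS x).card = p := by rw [wS, card_erase_of_mem (dpos_mem x), card_lead]; rfl
/-- The witness position is not in `S`. [folklore] -/ theorem dpos_notMem_wS : dpos x ∉ wS x := notMem_erase _ _
/-- `T = {witness} ∪ S`. [folklore] -/
theorem lead_eq_insert : lead x = insert (dpos x) (wS x) := (insert_erase (dpos_mem x)).symm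
/-- Membership in `dlist`. [folklore] -/
theorem mem_dlist {d : Fin n × Fin n} : d ∈ dlist x ↔ ∃ b ∈ colSet x, (perm x b, b) = d := by simp [dlist, colList, grEmb_apply]

end Components

/-! ### The value at the leading index -/

section Value

variable (x : Idx n p k σ)

/-- `col :: colList` has no duplicates. [folklore] -/
theorem nodup_cons_colList : (col x :: colList x).Nodup := by
  rw [List.nodup_cons, colList, mem_toList]; exact ⟨col_notMem_colSet x, nodup_toList _⟩
/-- `(row, col) :: dlist` is the graph of `perm` over `col :: colList`. [folklore] -/
theorem cons_dlist_eq : (row x, col x) :: dlist x = (col x :: colList x).map (grEmb (perm x)) := by rw [List.map_cons, grEmb_apply, perm_col]; rfl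

/-- `∂_{(row,col)} ∂^{dlist} det_n` is the canonical derivative for `(perm, J')`. [folklore] -/
theorem iterPDeriv_cons_dlist_det :
    iterPDeriv ((row x, col x) :: dlist x) (detPoly (Fin n) K) = canon (sgnK K n) (perm x) (colL x) := by
  rw [detPoly_eq_permSum]
  refine iterPDeriv_permSum _ (perm x) (colL x) _ ?_ ?_
  · rw [cons_dlist_eq]
    exact (nodup_cons_colList x).map (grEmb (perm x)).injective
  · rw [cons_dlist_eq, ← insert_erase (col_mem x)]
    ext v
    simp only [List.mem_toFinset, List.mem_map, List.mem_cons, colList, mem_toList, mem_map, mem_insert, colSet]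

/-- **Value at the leading index**: `ε(S, w) · (± the minor off rows `I'`, columns `J'`)`, in numbered coordinates. [folklore] -/
theorem kyImage_lead :
    kyImage (detFin K n) (dl x) (wS x) (lead x) =
      (koszulSign (wS x) (dpos x) : MvPolynomial (Fin (n * n)) K) *
        rename (vpos n) (canon (sgnK K n) (perm x) (colL x)) := by
  rw [lead_eq_insert, kyImage_apply_insert _ _ (dpos_notMem_wS x), detFin, dl,
    iterPDeriv_rename (vpos n).injective, dpos, pderiv_rename (vpos n).injective,
    ← iterPDeriv_cons, iterPDeriv_cons_dlist_det]

/-- The value at the leading index is nonzero. [folklore] -/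
theorem kyImage_lead_ne_zero : kyImage (detFin K n) (dl x) (wS x) (lead x) ≠ 0 := by
  rw [kyImage_lead]; exact mul_ne_zero (koszulSign_cast_ne_zero _ _)
    ((map_ne_zero_iff _ (rename_injective _ (vpos n).injective)).2 (canon_sgn_ne_zero _ _))

/-- The support of the leading value lies in the (transported) support of the canonical derivative. [folklore] -/
theorem support_value_subset :
    (kyImage (detFin K n) (dl x) (wS x) (lead x)).support ⊆
      (canon (sgnK K n) (perm x) (colL x)).support.image (Finsupp.mapDomain (vpos n)) := by
  rw [kyImage_lead, ← map_intCast (C : K →+* MvPolynomial (Fin (n * n)) K), C_mul',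
    ← support_rename_of_injective (vpos n).injective]
  exact support_smul

end Value

/-! ### Vanishing above the leading index (the new step: positions in the block give a repeated row or column) -/

section Triangular

variable (x : Idx n p k σ)

/-- A position `q` in the block kills the derivative: `∂_q ∂^{dlist} det_n = 0`. [folklore] -/
theorem iterPDeriv_cons_dlist_eq_zero_of_block {q : Fin n × Fin n}
    (hq : vpos n q ∈ block n (rowL x) (colL x) (row x) (col x)) :
    iterPDeriv (q :: dlist x) (detPoly (Fin n) K) = 0 := by
  rw [detPoly_eq_permSum]
  apply iterPDeriv_permSum_eq_zero
  intro π ⟨hnd, hgr⟩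
  have hq' : q.1 ∈ rowSet x ∨ q.2 ∈ colSet x := by
    rw [block, mem_filter, Equiv.symm_apply_apply] at hq
    exact hq.2
  have hqπ : π q.2 = q.1 := (mem_offGraph.1 (hgr q (by simp))).2
  -- a derivative position sharing a row or a column with `q`
  obtain ⟨b, hb, hrow_or_col⟩ : ∃ b ∈ colSet x, perm x b = q.1 ∨ b = q.2 := by
    rcases hq' with h | h
    · rw [← map_perm_colSet, mem_map] at h
      obtain ⟨b, hb, hbq⟩ := h
      exact ⟨b, hb, Or.inl hbq⟩
    · exact ⟨q.2, h, Or.inr rfl⟩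
  have hd : (perm x b, b) ∈ dlist x := (mem_dlist x).2 ⟨b, hb, rfl⟩
  have hdπ : π b = perm x b := (mem_offGraph.1 (hgr _ (List.mem_cons_of_mem _ hd))).2
  have hqd : q = (perm x b, b) := by
    rcases hrow_or_col with h | h
    · -- same row: π q.2 = q.1 = perm b = π b ⇒ q.2 = b
      have h2 : q.2 = b := π.injective (by rw [hqπ, ← h, hdπ])
      exact Prod.ext (by rw [← h]) h2
    · -- same column: q.1 = π q.2 = π b = perm b
      subst h
      exact Prod.ext (by rw [← hqπ, hdπ]) rfl
  rw [hqd] at hnd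
  exact (List.nodup_cons.1 hnd).1 hd

/-- **Triangularity**: the image of the member `x` vanishes at every `T ≠ lead x` that is `σ`-colex-`≥ lead x`. [folklore] -/
theorem kyImage_eq_zero_of_le (T : Finset (Fin (n * n))) (hT : T ≠ lead x)
    (hle : toColex ((lead x).map σ.toEmbedding) ≤ toColex (T.map σ.toEmbedding)) :
    kyImage (detFin K n) (dl x) (wS x) T = 0 := by
  by_cases h : ∃ q, q ∉ wS x ∧ T = insert q (wS x)
  · obtain ⟨q, hq, rfl⟩ := h
    rw [kyImage_apply_insert _ _ hq]
    have hqw : q ≠ dpos x := fun h => hT (by rw [h, lead_eq_insert])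
    rcases lt_or_gt_of_ne (σ.injective.ne hqw) with hlt | hgt
    · -- `σ q < σ w`: then `S ⊔ q` is σ-colex-below `S ⊔ w = lead`, contradicting `hle`
      exfalso
      have hq' : σ q ∉ (wS x).map σ.toEmbedding := by rwa [mem_map_equiv, Equiv.symm_apply_apply]
      have hw' : σ (dpos x) ∉ (wS x).map σ.toEmbedding := by
        rw [mem_map_equiv, Equiv.symm_apply_apply]; exact dpos_notMem_wS x
      have hlt' := (Colex.insert_lt_insert hq' hw').2 hlt
      rw [lead_eq_insert, map_insert, map_insert] at hle
      exact absurd hle (not_le.2 hlt')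
    · -- `σ q > σ w`: `q ∉ T(x)`, so `q` is in the block and the derivative vanishes
      have hqT : q ∉ lead x := by
        rw [lead_eq_insert, mem_insert, not_or]; exact ⟨hqw, hq⟩
      have hblk := block_of_gt x hgt hqT
      obtain ⟨q', rfl⟩ : ∃ q', vpos n q' = q := ⟨(vpos n).symm q, (vpos n).apply_symm_apply q⟩
      rw [detFin, dl, iterPDeriv_rename (vpos n).injective, pderiv_rename (vpos n).injective, ← iterPDeriv_cons,
        iterPDeriv_cons_dlist_eq_zero_of_block x hblk, map_zero, mul_zero]
  · exact kyImage_apply_eq_zero _ _ _ _ fun j hj hT' => h ⟨j, hj, hT'⟩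

/-- **Diagonal blocks**: distinct labels with the same leading set have disjointly supported leading values. [folklore] -/
theorem disjoint_support_lead {x y : Idx n p k σ} (hxy : x ≠ y) (hlead : lead x = lead y) :
    Disjoint (kyImage (detFin K n) (dl x) (wS x) (lead x)).support
      (kyImage (detFin K n) (dl y) (wS y) (lead y)).support := by
  have hlab : ¬ (colL x = colL y ∧
      (colL x).map (perm x).toEmbedding = (colL y).map (perm y).toEmbedding) := by
    rintro ⟨hB, hmap⟩
    rw [map_perm_colL, map_perm_colL] at hmap
    apply hxy
    apply Subtype.ext
    exact Prod.ext hlead (Prod.ext hmap hB)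
  refine Disjoint.mono (support_value_subset x) (support_value_subset y) ?_
  rw [disjoint_image (Finsupp.mapDomain_injective (vpos n).injective)]
  exact disjoint_support_canon _ _ hlab

end Triangular

/-! ### The lower bound -/

section Bound

variable (K : Type*) [Field K]

/-- **`LT2_σ(n,p,k) ≤ rank KY_{p,k}(det_n)`** in numbered coordinates, any field, any order `σ`. [folklore] -/
theorem lt2Count_le_kyRankFin_detFin (n p k : ℕ) (σ : Equiv.Perm (Fin (n * n))) :
    lt2Count n p k σ ≤ kyRankFin K p k (detFin K n) := by
  rw [← card_Idx]
  exact card_le_kyRankFin_of_leading_disjoint (detFin K n) (fun x : Idx n p k σ => dl x) (fun x => wS x)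
    (fun x => length_dl x) (fun x => card_wS x) (fun x => lead x) (fun T => toColex (T.map σ.toEmbedding))
    (fun x T hT hle => kyImage_eq_zero_of_le x T hT hle) (fun x => kyImage_lead_ne_zero x)
    (fun x y hxy hl => disjoint_support_lead hxy hl)

/-- **`LT2_σ(n,p,k) ≤ rank KY_{p,k}(det_n)`**, numbering-free form. [folklore] -/
theorem lt2Count_le_kyRank_detPoly (n p k : ℕ) (σ : Equiv.Perm (Fin (n * n))) :
    lt2Count n p k σ ≤ kyRank K p k (detPoly (Fin n) K) := by
  rw [kyRank_detPoly_eq_kyRankFin_detFin]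
  exact lt2Count_le_kyRankFin_detFin K n p k σ

/-- Both counts at once with the transpose duality (characteristic `0`): for `p + 1 ≤ n²`, `k + 1 ≤ n` and any two orders,
`max (LT2_σ(n,p,k)) (LT2_τ(n, n²-1-p, n-1-k)) ≤ rank KY_{p,k}(det_n)`. [folklore] -/
theorem max_lt2Count_le_kyRank_detPoly [CharZero K] (n p k : ℕ) (σ τ : Equiv.Perm (Fin (n * n)))
    (hp : p + 1 ≤ n * n) (hk : k + 1 ≤ n) :
    max (lt2Count n p k σ) (lt2Count n (n * n - 1 - p) (n - 1 - k) τ) ≤ kyRank K p k (detPoly (Fin n) K) := by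
  refine max_le (lt2Count_le_kyRank_detPoly K n p k σ) ?_
  rw [DetKYLeadingTerms.kyRank_detPoly_dual K n p k hp hk]
  exact lt2Count_le_kyRank_detPoly K _ _ _ τ

end Bound

/-! ### Kernel sanity -/

example : lt2Count 3 4 1 1 = 726 := by decide +kernel

end DetKYLeadingTermsTwo

/-! ## The packaged statement of this module (PROVED) -/

/-- **Order-optimised distinct-leading-term bound** (theory-2 FINDINGS-LT2 Thm 1): for every `n, p, k` and every total order of the
matrix positions (`σ : Equiv.Perm (Fin (n*n))`), the number `LT2_σ(n,p,k)` of `σ`-achievable labels is at most `rank KY_{p,k}(det_n)` (over `ℂ`;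
`DetKYLeadingTermsTwo.lt2Count_le_kyRank_detPoly` holds over any field). A statement of the cell, PROVED below; not a published theorem. [folklore] -/
def DetKYLeadingTermBoundTwo : Prop :=
  ∀ (n p k : ℕ) (σ : Equiv.Perm (Fin (n * n))),
    DetKYLeadingTermsTwo.lt2Count n p k σ ≤ kyRank ℂ p k (detPoly (Fin n) ℂ)

/-- `DetKYLeadingTermBoundTwo` holds. [folklore] -/
theorem detKYLeadingTermBoundTwo_holds : DetKYLeadingTermBoundTwo :=
  fun n p k σ => DetKYLeadingTermsTwo.lt2Count_le_kyRank_detPoly ℂ n p k σ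

/-- **Two orders at once** (the form the cell tables use): for `p + 1 ≤ n²`, `k + 1 ≤ n` and any orders `σ, τ`,
`max (LT2_σ(n,p,k)) (LT2_τ(n, n²-1-p, n-1-k)) ≤ rank KY_{p,k}(det_n)` (transpose duality of `det_n`). PROVED below. [folklore] -/
def DetKYLeadingTermBoundTwoDual : Prop :=
  ∀ (n p k : ℕ) (σ τ : Equiv.Perm (Fin (n * n))), p + 1 ≤ n * n → k + 1 ≤ n →
    max (DetKYLeadingTermsTwo.lt2Count n p k σ) (DetKYLeadingTermsTwo.lt2Count n (n * n - 1 - p) (n - 1 - k) τ) ≤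
      kyRank ℂ p k (detPoly (Fin n) ℂ)

/-- `DetKYLeadingTermBoundTwoDual` holds. [folklore] -/
theorem detKYLeadingTermBoundTwoDual_holds : DetKYLeadingTermBoundTwoDual :=
  fun n p k σ τ hp hk => DetKYLeadingTermsTwo.max_lt2Count_le_kyRank_detPoly ℂ n p k σ τ hp hk

end Summit.PneNP.GCT
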